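import Literature.NumberTheory.Automorphic.SiegelConeCountExponent
import Literature.NumberTheory.Automorphic.SiegelSetWeightedVolume
import Literature.NumberTheory.Automorphic.HermitianRationalPointCount
import Literature.NumberTheory.Automorphic.GodementCompactness
import Literature.NumberTheory.Automorphic.AutomorphicGaloisConj
import HarnessLib

/-!
# The hermitian lattice-point count is integrable over a Siegel set of `GL_N(𝔸_L)`

Topic `NumberTheory/Automorphic`; namespace `Literature.NumberTheory.Automorphic`. Proof file
(theorems only). For a CM field `L` with complex conjugation `c` and a compact
`B ⊆ M_N(𝔸_L)`, the number of rational hermitian matrices `h ∈ M_N(L)` (`ᵗh̄ = h`) with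
`ᵗḡ h g ∈ B` — the count `Θ_B(g)` that dominates the folded kernel in the orbit-count unfolding of
`vol(U(H)(L⁺)\U(H)(𝔸_{L⁺}))` against `GL_N(L)\GL_N(𝔸_L)` — is integrable over every Siegel set
`Z · Ω · A_{T₀}(t) · K` of `GL_N(𝔸_L)` (Borel (1963), Thm. 5.8, for unitary groups; Siegel–Weil
unfolding). The three inputs are in the tree: the box count `ncard_hermitian_principal_box_le`
(`Θ_B(diag(z(a)) c) ≪ ∏_{i<j} max(1,(aᵢaⱼ)⁻¹)^{d} ∏ᵢ max(1,aᵢ⁻²)^{d/2}`, `d = [L:ℚ]`), the cone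
inequality `prod_max_inv_le_mul_prod_root_rpow` and the explicit modulus
`unipotentConjChar_posRealIdele_eq`; this file combines them into

* `hermitianBoxBound_le_mul_unipotentConjChar_rpow` — **on the cone `∏ aᵢ = 1`, `t aᵢ₊₁ ≤ aᵢ` the box
  bound is `≤ C · δ_B(a)^{(N-1)/N}`** (`δ_B(a) = unipotentConjChar (z ∘ a)`),

the hypothesis of the weighted Siegel-set volume `lintegral_siegelSet_lt_top_of_torus_bound`
(`SiegelSetWeightedVolume`) with `θ = 1 - 1/N < 1`; and

* `lintegral_ncard_hermitianOrbitSet_siegelSet_lt_top` — **`∫_{Z Ω A_{T₀}(t) K} #{h : ᵗh̄ = h,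
  ᵗḡ h g ∈ B} dμ(g) < ∞`**, the export consumed by the finite-covolume assembly
  (`UnitaryGroupFiniteCovolume`).

## References

* A. Borel, *Some finiteness properties of adele groups over number fields*, Publ. Math. IHÉS 16
  (1963), §5, Thm. 5.8 [Borel1963].
* R. Godement, *Domaines fondamentaux des groupes arithmétiques*, Sém. Bourbaki 257 (1962/63), §8
  [Godement1964].
-/

noncomputable section

open MeasureTheory Measure NumberField IsDedekindDomain Matrix Set
open scoped MatrixGroups ENNReal NNReal Pointwise

namespace Literature.NumberTheory.Automorphic

section ConeBound

variable {n : ℕ} {K : Type} [Field K] [NumberField K]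

/-- `max(1, (x²)⁻¹)^{(d/2)} ≤ max(1, x⁻¹)^d` for `x > 0` and a natural number `d` (natural division).
[folklore] -/
private theorem max_one_inv_sq_pow_le {x : ℝ} (hx : 0 < x) (d : ℕ) :
    max 1 ((x ^ 2)⁻¹) ^ (d / 2) ≤ (max 1 x⁻¹) ^ d := by
  have hsq : max 1 ((x ^ 2)⁻¹) = (max 1 x⁻¹) ^ 2 := by
    rcases le_total 1 x with h | h
    · have h1 : (x ^ 2)⁻¹ ≤ 1 := inv_le_one_of_one_le₀ (one_le_pow₀ h)
      rw [max_eq_left h1, max_eq_left (inv_le_one_of_one_le₀ h), one_pow]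
    · have h2 : 1 ≤ x⁻¹ := one_le_inv₀ hx |>.2 h
      have h3 : 1 ≤ (x ^ 2)⁻¹ := by rw [← inv_pow]; exact one_le_pow₀ h2
      rw [max_eq_right h3, max_eq_right h2, inv_pow]
  rw [hsq, ← pow_mul]
  exact pow_le_pow_right₀ (le_max_left _ _) (by omega)

variable (n K) in
/-- **The hermitian box bound against the modulus on the cone.** For `t > 0` there is `C` such that
for every cone parameter `a` (`∏ aᵢ = 1`, `t aᵢ₊₁ ≤ aᵢ`),
`∏_{i<j} max(1, (aᵢaⱼ)⁻¹)^{[K:ℚ]} · ∏ᵢ max(1, aᵢ⁻²)^{[K:ℚ]/2} ≤ C · δ_B(a)^{(n-1)/n}` with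
`δ_B(a) = unipotentConjChar (z ∘ a) = (∏_{i<j} aᵢ/aⱼ)^{[K:ℚ]}` (`prod_max_inv_le_mul_prod_root_rpow`,
`unipotentConjChar_posRealIdele_eq`, `siegelRoot_div_le_max_pow`). This is the growth estimate of the
hermitian lattice count on a Siegel set behind Borel (1963), Thm. 5.8 for unitary groups.
[cite: Borel1963, Thm. 5.8] -/
theorem hermitianBoxBound_le_mul_unipotentConjChar_rpow [LocallyCompactSpace (AdeleRing (𝓞 K) K)]
    {t : ℝ} (ht : 0 < t) :
    ∃ C : ℝ≥0, ∀ a : Fin n → ℝ≥0ˣ, (∏ i, ((a i : ℝ≥0) : ℝ)) = 1 →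
      (∀ i j : Fin n, (j : ℕ) = (i : ℕ) + 1 → t * ((a j : ℝ≥0) : ℝ) ≤ ((a i : ℝ≥0) : ℝ)) →
      (∏ i : Fin n, ∏ j : Fin n,
          (if i < j then max 1 ((((a i : ℝ≥0) : ℝ) * ((a j : ℝ≥0) : ℝ))⁻¹) ^ Module.finrank ℚ K else 1)) *
        ∏ i : Fin n, max 1 ((((a i : ℝ≥0) : ℝ) ^ 2)⁻¹) ^ (Module.finrank ℚ K / 2) ≤
      (C : ℝ) * ((unipotentConjChar (fun i => posRealIdele K (a i)) : ℝ≥0) : ℝ) ^ (((n : ℝ) - 1) / n) := by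
  obtain ⟨c, hc0, hT3⟩ := prod_max_inv_le_mul_prod_root_rpow n
  set M : ℝ := (max 1 t⁻¹) ^ n with hM
  have hM1 : 1 ≤ M := one_le_pow₀ (le_max_left _ _)
  set d : ℕ := Module.finrank ℚ K with hd
  have hC0 : 0 ≤ (M ^ c) ^ d := pow_nonneg (Real.rpow_nonneg (by linarith) _) _
  refine ⟨⟨(M ^ c) ^ d, hC0⟩, fun a hprod hroot => ?_⟩
  have hapos : ∀ i, 0 < ((a i : ℝ≥0) : ℝ) := fun i =>
    NNReal.coe_pos.2 (pos_iff_ne_zero.2 (a i).ne_zero)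
  -- the slack form of the cone condition
  have hcone : ∀ i j : Fin n, i < j → ((a j : ℝ≥0) : ℝ) ≤ M * ((a i : ℝ≥0) : ℝ) := by
    intro i j hij
    have h := siegelRoot_div_le_max_pow (n := n) ht hroot hij.le
    rwa [div_le_iff₀ (hapos i)] at h
  have key := hT3 M hM1 (fun i => ((a i : ℝ≥0) : ℝ)) hapos hprod hcone
  -- abbreviations
  set F₁ : ℝ := (∏ i : Fin n, ∏ j : Fin n,
      (if i < j then max 1 ((((a i : ℝ≥0) : ℝ) * ((a j : ℝ≥0) : ℝ))⁻¹) else 1)) *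
    ∏ i : Fin n, max 1 (((a i : ℝ≥0) : ℝ))⁻¹ with hF₁
  set root : ℝ := ∏ i : Fin n, ∏ j : Fin n,
      (if i < j then ((a i : ℝ≥0) : ℝ) / ((a j : ℝ≥0) : ℝ) else 1) with hroot_def
  have hroot_nn : 0 ≤ root := Finset.prod_nonneg fun i _ => Finset.prod_nonneg fun j _ => by
    split_ifs
    · exact (div_pos (hapos i) (hapos j)).le
    · exact zero_le_one
  have hF₁nn : 0 ≤ F₁ := mul_nonneg
    (Finset.prod_nonneg fun i _ => Finset.prod_nonneg fun j _ => by split_ifs <;> positivity)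
    (Finset.prod_nonneg fun i _ => by positivity)
  -- Step 1: the box bound is at most `F₁^d`
  have h1 : (∏ i : Fin n, ∏ j : Fin n,
        (if i < j then max 1 ((((a i : ℝ≥0) : ℝ) * ((a j : ℝ≥0) : ℝ))⁻¹) ^ d else 1)) *
        ∏ i : Fin n, max 1 ((((a i : ℝ≥0) : ℝ) ^ 2)⁻¹) ^ (d / 2) ≤ F₁ ^ d := by
    have e1 : (∏ i : Fin n, ∏ j : Fin n,
        (if i < j then max 1 ((((a i : ℝ≥0) : ℝ) * ((a j : ℝ≥0) : ℝ))⁻¹) ^ d else 1)) =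
        (∏ i : Fin n, ∏ j : Fin n,
          (if i < j then max 1 ((((a i : ℝ≥0) : ℝ) * ((a j : ℝ≥0) : ℝ))⁻¹) else 1)) ^ d := by
      rw [← Finset.prod_pow]
      refine Finset.prod_congr rfl fun i _ => ?_
      rw [← Finset.prod_pow]
      refine Finset.prod_congr rfl fun j _ => ?_
      split_ifs
      · rfl
      · rw [one_pow]
    have e2 : ∏ i : Fin n, max 1 ((((a i : ℝ≥0) : ℝ) ^ 2)⁻¹) ^ (d / 2) ≤
        (∏ i : Fin n, max 1 (((a i : ℝ≥0) : ℝ))⁻¹) ^ d := by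
      rw [← Finset.prod_pow]
      exact Finset.prod_le_prod (fun i _ => by positivity) fun i _ => max_one_inv_sq_pow_le (hapos i) d
    rw [e1, hF₁, mul_pow]
    gcongr
  -- Step 2: `F₁^d ≤ (M^c root^θ)^d = (M^c)^d · χ^θ`
  set θ : ℝ := ((n : ℝ) - 1) / n with hθ
  have h2 : F₁ ^ d ≤ (M ^ c) ^ d * (root ^ d) ^ θ := by
    calc F₁ ^ d ≤ (M ^ c * root ^ θ) ^ d := pow_le_pow_left₀ hF₁nn key d
      _ = (M ^ c) ^ d * (root ^ θ) ^ d := mul_pow _ _ _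
      _ = (M ^ c) ^ d * (root ^ d) ^ θ := by
          congr 1
          rw [← Real.rpow_natCast, ← Real.rpow_natCast, ← Real.rpow_mul hroot_nn,
            ← Real.rpow_mul hroot_nn, mul_comm]
  have h3 : root ^ d = ((unipotentConjChar (fun i => posRealIdele K (a i)) : ℝ≥0) : ℝ) := by
    rw [unipotentConjChar_posRealIdele_eq]
  calc _ ≤ F₁ ^ d := h1
    _ ≤ (M ^ c) ^ d * (root ^ d) ^ θ := h2
    _ = _ := by rw [h3]; rfl

end ConeBound

/-! ### The hermitian lattice-point count is integrable over Siegel sets -/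

/-! ### The box form of the hermitian orbit count on `diag(z(a)) · C₀` -/

section Box

variable (L : Type) [Field L] [NumberField L] [IsCMField L] (N : ℕ)

/-- Complex conjugation `c ⊗ 1` of `𝔸_L` fixes the real scalars `(r, 1)` (`realAdele`): the archimedean
part is a diagonal real scalar (`InfiniteAdeleRing.smul_realToInfiniteAdele`), the finite part is `1`.
[folklore] -/
private theorem adeleConj_realAdele (r : ℝ) : adeleConj L (realAdele L r) = realAdele L r := by
  rw [adeleConj_apply]
  refine Prod.ext ?_ ?_
  · rw [AdeleRing.smul_fst]
    exact InfiniteAdeleRing.smul_realToInfiniteAdele (↥(maximalRealSubfield L)) _ r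
  · rw [AdeleRing.smul_snd]
    change (IsCMField.complexConj L) • (realAdele L r).2 = (realAdele L r).2
    rw [realAdele_snd, smul_one]

/-- `diag(z(a))` is fixed by `c ⊗ 1` entrywise. [folklore] -/
private theorem map_adeleConj_posRealDiagonal (a : Fin N → ℝ≥0ˣ) :
    (posRealDiagonal N L a : Matrix (Fin N) (Fin N) (AdeleRing (𝓞 L) L)).map (adeleConj L) =
      (posRealDiagonal N L a : Matrix (Fin N) (Fin N) (AdeleRing (𝓞 L) L)) := by
  rw [coe_posRealDiagonal, Matrix.diagonal_map (map_zero _)]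
  congr 1
  funext i
  rw [coe_posRealIdele, adeleConj_realAdele]

/-- **Box form of the hermitian orbit count.** For compact `B ⊆ M_N(𝔸_L)` and compact `C₀ ⊆ GL_N(𝔸_L)`
there is a compact `B₂ ⊆ M_N(𝔸_L)` such that for every positive real diagonal `a` and every `c ∈ C₀`,
every rational hermitian `h` with `ᵗ(c̄ (diag(z(a)) c)) h (diag(z(a)) c) ∈ B` satisfies
`diag(z(a)) h diag(z(a)) ∈ B₂` (`B₂ = {ᵗ(c̄⁻¹) b c⁻¹}`; `diag(z(a))` is real, hence `c`-fixed and
symmetric). [folklore] -/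
private theorem exists_isCompact_hermitianOrbitSet_box
    {B : Set (Matrix (Fin N) (Fin N) (AdeleRing (𝓞 L) L))} (hB : IsCompact B)
    {C₀ : Set (GL (Fin N) (AdeleRing (𝓞 L) L))} (hC₀ : IsCompact C₀) :
    ∃ B₂ : Set (Matrix (Fin N) (Fin N) (AdeleRing (𝓞 L) L)), IsCompact B₂ ∧
      ∀ (a : Fin N → ℝ≥0ˣ) (c : GL (Fin N) (AdeleRing (𝓞 L) L)), c ∈ C₀ →
        {h : Matrix (Fin N) (Fin N) L | (h.map (cmConjRingHom L))ᵀ = h ∧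
            (Godement.conjAct L).act (h.map (algebraMap L (AdeleRing (𝓞 L) L)))
              (posRealDiagonal N L a * c) ∈ B} ⊆
        {h : Matrix (Fin N) (Fin N) L | (h.map (cmConjRingHom L))ᵀ = h ∧
            (posRealDiagonal N L a : Matrix (Fin N) (Fin N) (AdeleRing (𝓞 L) L)) *
                h.map (algebraMap L (AdeleRing (𝓞 L) L)) *
              (posRealDiagonal N L a : Matrix (Fin N) (Fin N) (AdeleRing (𝓞 L) L)) ∈ B₂} := by
  -- the compact set `B₂ = {ᵗ(c̄⁻¹) b c⁻¹ : c ∈ C₀, b ∈ B}`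
  set Φ : GL (Fin N) (AdeleRing (𝓞 L) L) × Matrix (Fin N) (Fin N) (AdeleRing (𝓞 L) L) →
      Matrix (Fin N) (Fin N) (AdeleRing (𝓞 L) L) := fun p =>
    (((p.1⁻¹ : GL (Fin N) (AdeleRing (𝓞 L) L)) : Matrix (Fin N) (Fin N) (AdeleRing (𝓞 L) L)).map
        (adeleConj L))ᵀ * p.2 *
      ((p.1⁻¹ : GL (Fin N) (AdeleRing (𝓞 L) L)) : Matrix (Fin N) (Fin N) (AdeleRing (𝓞 L) L)) with hΦ
  have hΦc : Continuous Φ := by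
    have hinv : Continuous fun p : GL (Fin N) (AdeleRing (𝓞 L) L) ×
        Matrix (Fin N) (Fin N) (AdeleRing (𝓞 L) L) =>
        ((p.1⁻¹ : GL (Fin N) (AdeleRing (𝓞 L) L)) : Matrix (Fin N) (Fin N) (AdeleRing (𝓞 L) L)) :=
      Units.continuous_val.comp (continuous_inv.comp continuous_fst)
    exact ((hinv.matrix_map (continuous_adeleConj L)).matrix_transpose.matrix_mul continuous_snd).matrix_mul
      hinv
  refine ⟨Φ '' (C₀ ×ˢ B), (hC₀.prod hB).image hΦc, fun a c hc => ?_⟩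
  rintro h ⟨hh, hact⟩
  refine ⟨hh, ⟨(c, _), ⟨hc, hact⟩, ?_⟩⟩
  -- `Φ (c, ᵗ(c̄ diag c̄) h_𝔸 (diag c)) = diag h_𝔸 diag`
  set Z : Matrix (Fin N) (Fin N) (AdeleRing (𝓞 L) L) :=
    (posRealDiagonal N L a : Matrix (Fin N) (Fin N) (AdeleRing (𝓞 L) L)) with hZ
  set C : Matrix (Fin N) (Fin N) (AdeleRing (𝓞 L) L) :=
    (c : Matrix (Fin N) (Fin N) (AdeleRing (𝓞 L) L)) with hC
  set C' : Matrix (Fin N) (Fin N) (AdeleRing (𝓞 L) L) :=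
    ((c⁻¹ : GL (Fin N) (AdeleRing (𝓞 L) L)) : Matrix (Fin N) (Fin N) (AdeleRing (𝓞 L) L)) with hC'
  have hZc : Z.map (adeleConj L) = Z := map_adeleConj_posRealDiagonal L N a
  have hZt : Zᵀ = Z := by rw [hZ, coe_posRealDiagonal, Matrix.diagonal_transpose]
  have h1 : C' * C = 1 := by rw [hC', hC, ← Units.val_mul, inv_mul_cancel, Units.val_one]
  have h2 : C * C' = 1 := by rw [hC', hC, ← Units.val_mul, mul_inv_cancel, Units.val_one]
  have h2' : (C'.map (adeleConj L))ᵀ * (C.map (adeleConj L))ᵀ = 1 := by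
    rw [← Matrix.transpose_mul, ← Matrix.map_mul, h2, Matrix.map_one _ (map_zero _) (map_one _),
      Matrix.transpose_one]
  simp only [hΦ, Godement.conjAct_act, Units.val_mul]
  rw [← hZ, ← hC, ← hC', Matrix.map_mul, hZc, Matrix.transpose_mul, hZt]
  -- `ᵗ(C̄') * ((ᵗC̄ * Z) * h * (Z * C)) * C' = Z h Z`
  calc (C'.map (adeleConj L))ᵀ * ((C.map (adeleConj L))ᵀ * Z * h.map (algebraMap L (AdeleRing (𝓞 L) L)) *
          (Z * C)) * C'
      = ((C'.map (adeleConj L))ᵀ * (C.map (adeleConj L))ᵀ) * (Z * h.map (algebraMap L (AdeleRing (𝓞 L) L)) * Z) *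
          (C * C') := by simp only [Matrix.mul_assoc]
    _ = Z * h.map (algebraMap L (AdeleRing (𝓞 L) L)) * Z := by rw [h2', h2, Matrix.one_mul, Matrix.mul_one]

end Box

section Integrable

variable (L : Type) [Field L] [NumberField L] [IsCMField L] (N : ℕ)

/-- **The hermitian lattice-point count is integrable over a Siegel set of `GL_N(𝔸_L)`.** For a CM
field `L`, a compact `B ⊆ M_N(𝔸_L)`, a Haar measure `μ` on `GL_N(𝔸_L)` and Siegel data `Z ⊆ A_G`
compact, `Ω ⊆ B(𝔸_L)` compact, `t > 0`:
`∫_{Z · Ω · A_{T₀}(t) · K} #{h ∈ M_N(L) : ᵗh̄ = h, ᵗḡ h g ∈ B} dμ(g) < ∞`. Proof: on the Siegel set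
`g = diag(z(a)) · c` with `c` in a compact set, so the count is the hermitian box count
(`exists_isCompact_hermitianOrbitSet_box`, `ncard_hermitian_principal_box_le`),
which is `≤ C δ_B(a)^{1-1/N}` on the cone (`hermitianBoxBound_le_mul_unipotentConjChar_rpow`); conclude
by the weighted Siegel-set volume `lintegral_siegelSet_lt_top_of_torus_bound` with `θ = 1 - 1/N < 1`.
This is the analytic heart of Borel (1963), Thm. 5.8 (finite volume of `G_k\G_A`) for the unitary groups
`U(H) ≤ GL_N` over `L⁺`, via the orbit-count unfolding against `GL_N(𝔸_L)`. [cite: Borel1963, Thm. 5.8] -/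
theorem lintegral_ncard_hermitianOrbitSet_siegelSet_lt_top
    [MeasurableSpace (GL (Fin N) (AdeleRing (𝓞 L) L))] [BorelSpace (GL (Fin N) (AdeleRing (𝓞 L) L))]
    (μ : Measure (GL (Fin N) (AdeleRing (𝓞 L) L))) [μ.IsHaarMeasure]
    {B : Set (Matrix (Fin N) (Fin N) (AdeleRing (𝓞 L) L))} (hB : IsCompact B)
    {Ω : Set (GL (Fin N) (AdeleRing (𝓞 L) L))} (hΩc : IsCompact Ω)
    (hΩB : Ω ⊆ (standardParabolicGL (AdeleRing (𝓞 L) L) (id : Fin N → Fin N) :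
      Set (GL (Fin N) (AdeleRing (𝓞 L) L))))
    {t : ℝ} (ht : 0 < t) {Z : Set (GL (Fin N) (AdeleRing (𝓞 L) L))} (hZc : IsCompact Z)
    (hZ : Z ⊆ Set.range (posRealScalar N L)) :
    ∫⁻ g in Z * (Ω * siegelCone N L t *
        (standardMaximalCompactGL N L : Set (GL (Fin N) (AdeleRing (𝓞 L) L)))),
      (({h : Matrix (Fin N) (Fin N) L | (h.map (cmConjRingHom L))ᵀ = h ∧
          (Godement.conjAct L).act (h.map (algebraMap L (AdeleRing (𝓞 L) L))) g ∈ B}.ncard : ℕ) :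
        ℝ≥0∞) ∂μ < ⊤ := by
  haveI : LocallyCompactSpace (AdeleRing (𝓞 L) L) := locallyCompactSpace_adeleRing' L
  -- the exponent `θ = 1 - 1/N ∈ [0, 1)`
  have hθ0 : (0 : ℝ) ≤ ((N : ℝ) - 1) / N := by
    rcases Nat.eq_zero_or_pos N with hN | hN
    · subst hN; simp
    · have h1 : (1 : ℝ) ≤ N := by exact_mod_cast hN
      exact div_nonneg (by linarith) (Nat.cast_nonneg _)
  have hθ1 : ((N : ℝ) - 1) / N < 1 := by
    rcases Nat.eq_zero_or_pos N with hN | hN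
    · subst hN; simp
    · rw [div_lt_one (by exact_mod_cast hN)]; linarith
  refine lintegral_siegelSet_lt_top_of_torus_bound μ hΩc hΩB ht hZc hZ hθ0 hθ1 fun C₀ hC₀ => ?_
  -- on `diag(z(a)) · C₀` the count is a hermitian box count
  obtain ⟨B₂, hB₂c, hsub⟩ := exists_isCompact_hermitianOrbitSet_box L N hB hC₀
  obtain ⟨C₂, hC₂, hT2⟩ := ncard_hermitian_principal_box_le L N hB₂c
  obtain ⟨C₃, hT3⟩ := hermitianBoxBound_le_mul_unipotentConjChar_rpow N L ht
  set C₂' : ℝ≥0 := C₂.toNNReal with hC₂'def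
  have hC₂' : ((C₂' : ℝ≥0) : ℝ) = C₂ := Real.coe_toNNReal C₂ hC₂.le
  refine ⟨C₂' * C₃, fun a hprod hroot c hc => ?_⟩
  obtain ⟨hfin, hle⟩ := hT2 a
  have hcone := hT3 a hprod hroot
  -- the chain `encard S ≤ ncard T ≤ C₂ · bound ≤ C₂ C₃ χ^θ`
  set T : Set (Matrix (Fin N) (Fin N) L) := {h : Matrix (Fin N) (Fin N) L |
      (h.map (cmConjRingHom L))ᵀ = h ∧
        (posRealDiagonal N L a : Matrix (Fin N) (Fin N) (AdeleRing (𝓞 L) L)) *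
            h.map (algebraMap L (AdeleRing (𝓞 L) L)) *
          (posRealDiagonal N L a : Matrix (Fin N) (Fin N) (AdeleRing (𝓞 L) L)) ∈ B₂} with hT
  have h1 : ({h : Matrix (Fin N) (Fin N) L | (h.map (cmConjRingHom L))ᵀ = h ∧
      (Godement.conjAct L).act (h.map (algebraMap L (AdeleRing (𝓞 L) L)))
        (posRealDiagonal N L a * c) ∈ B}.ncard : ℕ) ≤ T.ncard :=
    Set.ncard_le_ncard (hsub a c hc) hfin
  have h3 : ((T.ncard : ℝ≥0) : ℝ) ≤
      (((C₂' * C₃ : ℝ≥0) * (unipotentConjChar (fun i => posRealIdele L (a i))) ^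
        (((N : ℝ) - 1) / N) : ℝ≥0) : ℝ) := by
    push_cast
    rw [hC₂', mul_assoc]
    rw [mul_assoc] at hle
    exact hle.trans (mul_le_mul_of_nonneg_left hcone hC₂.le)
  have h3' : (T.ncard : ℝ≥0) ≤ (C₂' * C₃ : ℝ≥0) *
      (unipotentConjChar (fun i => posRealIdele L (a i))) ^ (((N : ℝ) - 1) / N) := by
    exact_mod_cast h3
  calc (({h : Matrix (Fin N) (Fin N) L | (h.map (cmConjRingHom L))ᵀ = h ∧
          (Godement.conjAct L).act (h.map (algebraMap L (AdeleRing (𝓞 L) L)))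
            (posRealDiagonal N L a * c) ∈ B}.ncard : ℕ) : ℝ≥0∞)
      ≤ ((T.ncard : ℕ) : ℝ≥0∞) := by exact_mod_cast h1
    _ = ((T.ncard : ℝ≥0) : ℝ≥0∞) := by simp
    _ ≤ _ := by exact_mod_cast h3'

end Integrable

end Literature.NumberTheory.Automorphic
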